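import Summits.CriticalPhenomena.SAWScalingLimit.Theorems.SAWDefectDecoherenceBoundaryClosureRLocalL1HolomorphicWeakLimit
import Summits.CriticalPhenomena.SAWScalingLimit.Theorems.SAWDefectDecoherenceBoundaryClosureRLocalL1SmoothToContinuous
import HarnessLib

/-!
# Holomorphic weak limits on the whole carrier: patching the ball representatives
(crux `BoundaryClosureR`, stmt-CriticalPhenomena-14004, line `pick-half-plane`, stub
`stub_holWeakLimits`; registered sub-goal `holWeakLimits_of_localL1`)

Inputs, all landed: the single-ball holomorphic representation of the weak-* limit `L` of the
normalised bulk functionals (`LocalL1.holomorphicWeakLimit_ball`, p94468: convergence on continuous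
compactly supported tests, additivity, homogeneity, `C_K` bounds, and on every ball with
`closedBall z₀ (3R) ⊆ carrier` a holomorphic `g` with `L φ = ∫ φ g` for smooth `φ` supported in
`ball z₀ R`), and the passage from smooth to continuous tests (`LocalL1.integral_rep_of_smooth_rep`,
p94507).

OUTPUT (`holWeakLimits_of_localL1`): from `ConjugateClassNegligible` and the local `L¹` law of the
root family, along a subsequence the normalised functionals converge, for EVERY continuous compactly
supported test `ψ` in the carrier, to `∫ ψ g` with ONE `g` HOLOMORPHIC ON THE CARRIER.

The work here is the patching (pure analysis):
* `eqOn_of_integral_smul_eq` — two functions continuous on an open `V` with the same integrals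
  against real smooth tests compactly supported in `V` agree on `V`
  (`IsOpen.ae_eq_zero_of_integral_contDiff_smul_eq_zero` + `Measure.eqOn_open_of_ae_eq`);
* `map_finset_sum_of_additive` — finite additivity of `L` on admissible tests;
* the main proof: choose radii `R z` with `closedBall z (3 R z) ⊆ carrier` and ball representatives
  `g z`; the diagonal `G w := g w w` agrees with `g z` on `ball z (R z)` (uniqueness on overlaps),
  hence is holomorphic; `L ψ = ∫ ψ G` for continuous `ψ` supported in a ball
  (`integral_rep_of_smooth_rep`), and for general `ψ` by a finite partition of unity on `tsupport ψ`
  subordinate to the balls.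
-/

noncomputable section

open scoped Topology ContDiff
open Filter Set Metric MeasureTheory
open Literature.Probability.LatticeModels Literature.Probability.RandomPlanarGeometry
open Literature.Probability.RandomPlanarGeometry.SAW
open Summit.CriticalPhenomena.SAWScalingLimit.Theses.SAWDefectDecoherence

namespace Summit.CriticalPhenomena.SAWScalingLimit.Theorems.PickHalfPlane.LocalL1

/-- **Uniqueness of continuous weak representatives.** Two functions continuous on an open set
`V ⊆ ℂ` whose integrals against every real smooth test function compactly supported in `V`
coincide agree everywhere on `V` (a.e. by `IsOpen.ae_eq_zero_of_integral_contDiff_smul_eq_zero`,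
everywhere by continuity, `Measure.eqOn_open_of_ae_eq`). [folklore] -/
theorem eqOn_of_integral_smul_eq {V : Set ℂ} (hV : IsOpen V) {g₁ g₂ : ℂ → ℂ}
    (h₁ : ContinuousOn g₁ V) (h₂ : ContinuousOn g₂ V)
    (h : ∀ χ : ℂ → ℝ, ContDiff ℝ ∞ χ → HasCompactSupport χ → tsupport χ ⊆ V →
      ∫ z, (χ z : ℂ) * g₁ z = ∫ z, (χ z : ℂ) * g₂ z) :
    EqOn g₁ g₂ V := by
  have hloc : LocallyIntegrableOn (fun z => g₁ z - g₂ z) V volume :=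
    (h₁.sub h₂).locallyIntegrableOn hV.measurableSet
  have hae : ∀ᵐ z ∂volume, z ∈ V → g₁ z - g₂ z = 0 := by
    refine hV.ae_eq_zero_of_integral_contDiff_smul_eq_zero hloc ?_
    intro χ hχ hχc hχV
    have hχt : tsupport (fun z => (χ z : ℂ)) ⊆ V :=
      (tsupport_comp_subset Complex.ofReal_zero χ).trans hχV
    have hχc' : HasCompactSupport (fun z => (χ z : ℂ)) := hχc.comp_left Complex.ofReal_zero
    have hχ' : Continuous (fun z => (χ z : ℂ)) := Complex.continuous_ofReal.comp hχ.continuous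
    have hi₁ : Integrable (fun z => (χ z : ℂ) * g₁ z) :=
      (continuous_mul_of_tsupport_subset hV subset_rfl hχ' hχt h₁).integrable_of_hasCompactSupport
        hχc'.mul_right
    have hi₂ : Integrable (fun z => (χ z : ℂ) * g₂ z) :=
      (continuous_mul_of_tsupport_subset hV subset_rfl hχ' hχt h₂).integrable_of_hasCompactSupport
        hχc'.mul_right
    simp_rw [Complex.real_smul, mul_sub]
    rw [integral_sub hi₁ hi₂, h χ hχ hχc hχV, sub_self]
  have hae' : (fun z => g₁ z - g₂ z) =ᵐ[volume.restrict V] fun _ => (0 : ℂ) :=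
    (ae_restrict_iff' hV.measurableSet).2 hae
  have heq := Measure.eqOn_open_of_ae_eq hae' hV (h₁.sub h₂) continuousOn_const
  intro z hz
  exact sub_eq_zero.1 (heq hz)

/-- **Finite additivity of the limit functional.** A functional on `C(ℂ, ℂ)` that is additive and
homogeneous on compactly supported tests with support in `U` is additive over finite sums of such
tests. [folklore] -/
theorem map_finset_sum_of_additive {L : C(ℂ, ℂ) → ℂ} {U : Set ℂ}
    (hadd : ∀ ψ₁ ψ₂ : C(ℂ, ℂ), HasCompactSupport ψ₁ → tsupport ψ₁ ⊆ U → HasCompactSupport ψ₂ →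
      tsupport ψ₂ ⊆ U → L (ψ₁ + ψ₂) = L ψ₁ + L ψ₂)
    (hsmul : ∀ (c : ℂ) (ψ : C(ℂ, ℂ)), HasCompactSupport ψ → tsupport ψ ⊆ U → L (c • ψ) = c * L ψ)
    {ι : Type*} (s : Finset ι) (Ψ : ι → C(ℂ, ℂ)) (hc : ∀ i ∈ s, HasCompactSupport (Ψ i))
    (hU : ∀ i ∈ s, tsupport (Ψ i) ⊆ U) :
    L (∑ i ∈ s, Ψ i) = ∑ i ∈ s, L (Ψ i) := by
  -- strengthen: also track the support of the partial sums
  suffices h : HasCompactSupport (⇑(∑ i ∈ s, Ψ i)) ∧ tsupport (⇑(∑ i ∈ s, Ψ i)) ⊆ U ∧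
      L (∑ i ∈ s, Ψ i) = ∑ i ∈ s, L (Ψ i) from h.2.2
  induction s using Finset.cons_induction with
  | empty =>
    have h0c : HasCompactSupport (⇑(0 : C(ℂ, ℂ))) := by
      rw [ContinuousMap.coe_zero]; exact HasCompactSupport.zero
    have h0U : tsupport (⇑(0 : C(ℂ, ℂ))) ⊆ U := by
      rw [ContinuousMap.coe_zero, tsupport_zero]; exact empty_subset _
    rw [Finset.sum_empty, Finset.sum_empty]
    refine ⟨h0c, h0U, ?_⟩
    have h0 := hsmul 0 0 h0c h0U
    have e : ((0 : ℂ) • (0 : C(ℂ, ℂ))) = 0 := by ext w; simp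
    rwa [e, zero_mul] at h0
  | cons a s ha ih =>
    obtain ⟨ihc, ihU, ihL⟩ := ih (fun i hi => hc i (Finset.mem_cons_of_mem hi))
      (fun i hi => hU i (Finset.mem_cons_of_mem hi))
    have hac := hc a (Finset.mem_cons_self a s)
    have haU := hU a (Finset.mem_cons_self a s)
    rw [Finset.sum_cons, Finset.sum_cons]
    refine ⟨?_, ?_, ?_⟩
    · rw [ContinuousMap.coe_add]; exact hac.add ihc
    · rw [ContinuousMap.coe_add]
      refine (closure_mono (Function.support_add _ _)).trans ?_
      rw [closure_union]
      exact union_subset haU ihU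
    · rw [hadd _ _ hac haU ihc ihU, ihL]

/-- **Holomorphic weak limits on the carrier (registered sub-goal `holWeakLimits_of_localL1`,
stub `stub_holWeakLimits` of line `pick-half-plane`, unfolded pointwise form).**  For an
admissible family (`AdmissibleFamily D ρ Λ m b`, unfolded) pinned at the flat root `D.pt 0`
(`PinnedFlatRoot`, unfolded), the route's `ConjugateClassNegligible` and the local `L¹` law of the
root family `a`: every mesh sequence `ns → 0⁺` has a subsequence `ns ∘ ms` and a function `g`
HOLOMORPHIC ON THE CARRIER such that the normalised bulk functionals converge to `∫ ψ g` for
every continuous compactly supported test `ψ` in the carrier.  Proof: the ball representatives of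
`holomorphicWeakLimit_ball` agree on overlaps (`eqOn_of_integral_smul_eq`), so their diagonal is
one holomorphic function; the representation passes to continuous tests in small balls
(`integral_rep_of_smooth_rep`) and to all tests by a finite partition of unity. [folklore] -/
theorem holWeakLimits_of_localL1 :
    ConjugateClassNegligible →
    ∀ (D : DobrushinDomain) (ρ : ℝ) (Λ : ℝ → Finset HexVertex) (m : ℝ → ℤ) (b : ℝ → Sym2 HexVertex),
      (0 < ρ ∧
        D.carrier ∩ Metric.ball (D.pt 1) ρ = {z : ℂ | (D.pt 1).im < z.im} ∩ Metric.ball (D.pt 1) ρ ∧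
        (∀ᶠ δ : ℝ in 𝓝[>] 0, hexDomainSimplyConnected (Λ δ) ∧ b δ ∈ hexDomainBoundary (Λ δ) ∧
            (hexGraph.induce ((Λ δ : Finset HexVertex) : Set HexVertex)).Preconnected ∧
            (∀ v ∈ Λ δ, (δ : ℂ) * hexCenter v ∈ D.carrier) ∧
            (∀ v : HexVertex, (δ : ℂ) * hexCenter v ∈ Metric.ball (D.pt 1) ρ →
              (v ∈ Λ δ ↔ m δ ≤ v.1 1))) ∧
        (∀ K : Set ℂ, IsCompact K → K ⊆ D.carrier →
            ∀ᶠ δ : ℝ in 𝓝[>] 0, ∀ v : HexVertex, (δ : ℂ) * hexCenter v ∈ K → v ∈ Λ δ) ∧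
        Tendsto (fun δ : ℝ => (δ : ℂ) * hexMidpoint (b δ)) (𝓝[>] 0) (𝓝 (D.pt 1))) →
    ∀ (a : ℝ → Sym2 HexVertex) (r₀ : ℝ) (m₀ : ℝ → ℤ),
      (0 < r₀ ∧
        D.carrier ∩ Metric.ball (D.pt 0) r₀ = {z : ℂ | (D.pt 0).im < z.im} ∩ Metric.ball (D.pt 0) r₀ ∧
        (∀ᶠ δ : ℝ in 𝓝[>] 0, a δ ∈ hexDomainBoundary (Λ δ) ∧
            Nonempty (HexMidEdgeSAW (Λ δ) (a δ) (b δ)) ∧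
            (∀ v : HexVertex, (δ : ℂ) * hexCenter v ∈ Metric.ball (D.pt 0) r₀ →
              (v ∈ Λ δ ↔ m₀ δ ≤ v.1 1))) ∧
        Tendsto (fun δ : ℝ => (δ : ℂ) * hexMidpoint (a δ)) (𝓝[>] 0) (𝓝 (D.pt 0))) →
    (∀ K : Set ℂ, IsCompact K → K ⊆ D.carrier → ∃ C : ℝ, ∀ᶠ δ : ℝ in 𝓝[>] 0,
      δ ^ 2 * (∑ᶠ z ∈ {z : Sym2 HexVertex | z ∈ hexDomainMidEdges (Λ δ) ∧
          (δ : ℂ) * hexMidpoint z ∈ K},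
        ‖hexParafermionicObservable (Λ δ) (a δ) hexCriticalFugacity (5 / 8) z‖) ≤
      C * ‖hexParafermionicObservable (Λ δ) (a δ) hexCriticalFugacity (5 / 8) (b δ)‖) →
    ∀ ns : ℕ → ℝ, Tendsto ns atTop (𝓝[>] 0) →
      ∃ ms : ℕ → ℕ, StrictMono ms ∧ ∃ g : ℂ → ℂ, DifferentiableOn ℂ g D.carrier ∧
      (∀ ψ : ℂ → ℂ, (Continuous ψ ∧ HasCompactSupport ψ ∧ tsupport ψ ⊆ D.carrier) →
        Tendsto (fun n => (((ns ∘ ms) n : ℝ) : ℂ) ^ 2 * (∑ᶠ z ∈ hexDomainMidEdges (Λ ((ns ∘ ms) n)),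
            ψ ((((ns ∘ ms) n : ℝ) : ℂ) * hexMidpoint z) *
              hexParafermionicObservable (Λ ((ns ∘ ms) n)) (a ((ns ∘ ms) n)) hexCriticalFugacity (5 / 8) z) /
          hexParafermionicObservable (Λ ((ns ∘ ms) n)) (a ((ns ∘ ms) n)) hexCriticalFugacity (5 / 8) (b ((ns ∘ ms) n)))
          atTop (𝓝 (∫ z, ψ z * g z))) := by
  intro hCCN D ρ Λ m b hAF a r₀ m₀ hPR hL1 ns hns
  have hx : D.pt 0 ≠ D.pt 1 := fun h => absurd (D.pt_injective h) (by decide)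
  obtain ⟨ms, hms, L, hconv, hadd, hsmul, hbd, -, hloc⟩ :=
    holomorphicWeakLimit_ball hCCN D ρ Λ m b hAF (D.pt 0) a r₀ m₀ hPR hx hL1 ns hns
  have hU : IsOpen D.carrier := D.isOpen
  ---------------------------------------------------------------- radii and ball representatives
  have hR : ∀ z : ℂ, ∃ R : ℝ, ∃ g : ℂ → ℂ, z ∈ D.carrier → (0 < R ∧
      Metric.closedBall z (3 * R) ⊆ D.carrier ∧ DifferentiableOn ℂ g (Metric.ball z (3 * R / 2)) ∧
      ∀ φ : ℂ → ℂ, ContDiff ℝ ∞ φ → HasCompactSupport φ → tsupport φ ⊆ Metric.ball z R →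
        ∀ Φ : C(ℂ, ℂ), (⇑Φ = φ) → L Φ = ∫ w, φ w * g w) := by
    intro z
    by_cases hz : z ∈ D.carrier
    · obtain ⟨ε, hε, hεU⟩ := Metric.isOpen_iff.1 hU z hz
      have hsub : Metric.closedBall z (3 * (ε / 4)) ⊆ D.carrier :=
        (Metric.closedBall_subset_ball (by linarith)).trans hεU
      obtain ⟨g, hg, hrep⟩ := hloc z (ε / 4) (by positivity) hsub
      exact ⟨ε / 4, g, fun _ => ⟨by positivity, hsub, hg, hrep⟩⟩
    · exact ⟨0, 0, fun h => absurd h hz⟩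
  choose R g hRg using hR
  ---------------------------------------------------------------- diagonal `G = g z` on `ball z (R z)`
  have hGg : ∀ z ∈ D.carrier, EqOn (fun w => g w w) (g z) (Metric.ball z (R z)) := by
    intro z hz w hw
    obtain ⟨hRz, hzU, hgz, hrepz⟩ := hRg z hz
    have hwU : w ∈ D.carrier := hzU ((Metric.ball_subset_closedBall.trans
      (Metric.closedBall_subset_closedBall (by linarith))) hw)
    obtain ⟨hRw, -, hgw, hrepw⟩ := hRg w hwU
    have hV : IsOpen (Metric.ball z (R z) ∩ Metric.ball w (R w)) := isOpen_ball.inter isOpen_ball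
    have key : EqOn (g w) (g z) (Metric.ball z (R z) ∩ Metric.ball w (R w)) := by
      refine eqOn_of_integral_smul_eq hV ?_ ?_ ?_
      · exact hgw.continuousOn.mono
          (inter_subset_right.trans (Metric.ball_subset_ball (by linarith)))
      · exact hgz.continuousOn.mono
          (inter_subset_left.trans (Metric.ball_subset_ball (by linarith)))
      · intro χ hχ hχc hχV
        have hφ : ContDiff ℝ ∞ (fun x => (χ x : ℂ)) := Complex.ofRealCLM.contDiff.comp hχ
        have hφc : HasCompactSupport (fun x => (χ x : ℂ)) := hχc.comp_left Complex.ofReal_zero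
        have hφt : tsupport (fun x => (χ x : ℂ)) ⊆ tsupport χ :=
          tsupport_comp_subset Complex.ofReal_zero χ
        obtain ⟨Φ, hΦ⟩ : ∃ Φ : C(ℂ, ℂ), ⇑Φ = fun x => (χ x : ℂ) :=
          ⟨⟨fun x => (χ x : ℂ), Complex.continuous_ofReal.comp hχ.continuous⟩, rfl⟩
        rw [← hrepw _ hφ hφc (hφt.trans (hχV.trans inter_subset_right)) Φ hΦ,
          ← hrepz _ hφ hφc (hφt.trans (hχV.trans inter_subset_left)) Φ hΦ]
    exact key ⟨hw, Metric.mem_ball_self hRw⟩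
  ---------------------------------------------------------------- `G` is holomorphic on the carrier
  have hGdiff : DifferentiableOn ℂ (fun w => g w w) D.carrier := by
    intro z hz
    obtain ⟨hRz, -, hgz, -⟩ := hRg z hz
    have hball : DifferentiableOn ℂ (fun w => g w w) (Metric.ball z (R z)) :=
      (hgz.mono (Metric.ball_subset_ball (by linarith))).congr (hGg z hz)
    exact (hball.differentiableAt
      (isOpen_ball.mem_nhds (Metric.mem_ball_self hRz))).differentiableWithinAt
  have hGcont : ContinuousOn (fun w => g w w) D.carrier := hGdiff.continuousOn
  ---------------------------------------------------------------- continuous tests in a ball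
  have hrepC : ∀ z ∈ D.carrier, ∀ ψ : C(ℂ, ℂ), HasCompactSupport ψ →
      tsupport ψ ⊆ Metric.ball z (R z) → L ψ = ∫ w, ψ w * g w w := by
    intro z hz ψ hψc hψB
    obtain ⟨hRz, hzU, -, hrepz⟩ := hRg z hz
    have hKU : Metric.closedBall z (R z) ⊆ D.carrier :=
      (Metric.closedBall_subset_closedBall (by linarith)).trans hzU
    obtain ⟨C, -, hC⟩ := hbd (Metric.closedBall z (R z)) (isCompact_closedBall _ _) hKU
    refine integral_rep_of_smooth_rep (V := Metric.ball z (R z)) (K := Metric.closedBall z (R z))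
      isOpen_ball (isCompact_closedBall _ _) Metric.ball_subset_closedBall
      (fun ψ₁ ψ₂ h₁ h₁' h₂ h₂' => hadd ψ₁ ψ₂ h₁ (h₁'.trans hKU) h₂ (h₂'.trans hKU))
      (fun c ψ h h' => hsmul c ψ h (h'.trans hKU)) hC (hGcont.mono hKU) ?_ ψ hψc hψB
    intro φ hφ hφc hφB Φ hΦ
    rw [hrepz φ hφ hφc hφB Φ hΦ]
    refine integral_congr_ae (Eventually.of_forall fun w => ?_)
    by_cases hw : w ∈ Metric.ball z (R z)
    · show φ w * g z w = φ w * g w w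
      have e : g w w = g z w := hGg z hz hw
      rw [e]
    · show φ w * g z w = φ w * g w w
      rw [image_eq_zero_of_notMem_tsupport (fun h => hw (hφB h)), zero_mul, zero_mul]
  ---------------------------------------------------------------- all tests: partition of unity
  have hrepG : ∀ ψ : C(ℂ, ℂ), HasCompactSupport ψ → tsupport ψ ⊆ D.carrier →
      L ψ = ∫ w, ψ w * g w w := by
    intro ψ hψc hψU
    have hS : IsCompact (tsupport ψ) := hψc
    -- a finite subcover of `tsupport ψ` by the balls `ball x (R x)`
    obtain ⟨t, htS, hcover⟩ := hS.elim_nhds_subcover (fun x => Metric.ball x (R x))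
      (fun x hx => isOpen_ball.mem_nhds (Metric.mem_ball_self (hRg x (hψU hx)).1))
    -- a partition of unity on `tsupport ψ` subordinate to it
    obtain ⟨f, hf⟩ := PartitionOfUnity.exists_isSubordinate hS.isClosed
      (fun i : t => Metric.ball (i : ℂ) (R i)) (fun _ => isOpen_ball) (by
        intro x hx
        obtain ⟨i, hi, hxi⟩ := mem_iUnion₂.1 (hcover hx)
        exact mem_iUnion.2 ⟨⟨i, hi⟩, hxi⟩)
    -- the pieces `(f i) ψ`
    obtain ⟨Ψ, hΨ⟩ : ∃ Ψ : t → C(ℂ, ℂ), ∀ i, ⇑(Ψ i) = fun w => ((f i w : ℝ) : ℂ) * ψ w :=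
      ⟨fun i => ⟨fun w => ((f i w : ℝ) : ℂ) * ψ w,
        (Complex.continuous_ofReal.comp (f i).continuous).mul ψ.continuous⟩, fun _ => rfl⟩
    have hΨc : ∀ i, HasCompactSupport (Ψ i) := fun i => by rw [hΨ i]; exact hψc.mul_left
    have hΨt : ∀ i, tsupport (Ψ i) ⊆ Metric.ball (i : ℂ) (R i) := fun i => by
      rw [hΨ i]
      exact tsupport_mul_subset_left.trans
        ((tsupport_comp_subset Complex.ofReal_zero _).trans (hf i))
    have hΨU : ∀ i, tsupport (Ψ i) ⊆ D.carrier := fun i => by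
      rw [hΨ i]; exact tsupport_mul_subset_right.trans hψU
    -- `ψ = ∑ i, Ψ i`
    have hsum' : ∀ w, ∑ i, Ψ i w = ψ w := by
      intro w
      simp only [hΨ]
      rw [← Finset.sum_mul]
      by_cases hw : w ∈ tsupport ψ
      · have h1 := f.sum_eq_one hw
        rw [finsum_eq_sum_of_fintype] at h1
        rw [← Complex.ofReal_sum, h1, Complex.ofReal_one, one_mul]
      · rw [image_eq_zero_of_notMem_tsupport hw, mul_zero]
    have hsum : ψ = ∑ i, Ψ i := ContinuousMap.ext fun w => by
      rw [ContinuousMap.sum_apply, hsum' w]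
    -- integrability of the pieces against `G`
    have hint : ∀ i, Integrable (fun w => Ψ i w * g w w) := fun i =>
      (continuous_mul_of_tsupport_subset hU subset_rfl (Ψ i).continuous (hΨU i)
        hGcont).integrable_of_hasCompactSupport (hΨc i).mul_right
    calc L ψ = L (∑ i, Ψ i) := by rw [← hsum]
      _ = ∑ i, L (Ψ i) :=
          map_finset_sum_of_additive hadd hsmul _ Ψ (fun i _ => hΨc i) (fun i _ => hΨU i)
      _ = ∑ i, ∫ w, Ψ i w * g w w :=
          Finset.sum_congr rfl fun i _ => hrepC i (hψU (htS i i.2)) (Ψ i) (hΨc i) (hΨt i)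
      _ = ∫ w, ∑ i, Ψ i w * g w w := (integral_finsetSum _ fun i _ => hint i).symm
      _ = ∫ w, ψ w * g w w := by
          refine integral_congr_ae (Eventually.of_forall fun w => ?_)
          show ∑ i, Ψ i w * g w w = ψ w * g w w
          rw [← Finset.sum_mul, hsum' w]
  ---------------------------------------------------------------- conclusion
  refine ⟨ms, hms, fun w => g w w, hGdiff, fun ψ hψ => ?_⟩
  obtain ⟨hψ, hψc, hψU⟩ := hψ
  have h := hconv ⟨ψ, hψ⟩ hψc hψU
  rw [hrepG ⟨ψ, hψ⟩ hψc hψU] at h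
  exact h

end Summit.CriticalPhenomena.SAWScalingLimit.Theorems.PickHalfPlane.LocalL1

end
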